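import Mathlib
import Summits.ValiantsHypothesis.ValiantsHypothesis.Theorems.BarrierLeverPartitionMinorsSubsetSumDoor

/-!
# Route BarrierLever — item `PartitionMinorsHitByVP` (stmt-ValiantsHypothesis-19717):
# INFORMATION-SET layouts (rows shattering a `κ`-set, columns a `κ`-cube) are hit — an unconditional
# exponential-size class reached by the subset-sum Vandermonde witness

Helper file (`--supports stmt-ValiantsHypothesis-19717`; cell valiant-natproofs, rung V4, 𝒟-side of
door (c); prover seat val-np-p3 gen 4). Definition-free, cone-free. Closes NO item.

**Theorem (`partitionMinor_hit_of_informationSet`, `b = 5`, `h ≥ 4`).** Let the columns `w_j` be ALL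
subsets of a block `T ⊆ Fin h`, and suppose the rows have an INFORMATION SET for `T`: coordinates
`e(c)` (`c ∈ T`; necessarily distinct) such that every pattern `W ⊆ T` occurs as
`{c ∈ T : e(c) ∈ u_i}` for some row `i` (equivalently — there being `2^|T|` rows — the trace of the
row family on `e(T)` is a bijection onto `𝒫(e(T))`: the rows SHATTER the `|T|`-set `e(T)` exactly,
VC-dimension `= log₂ r`).
Then the layout is hit inside `SmallCircuits ℂ (h+h) 5`.

Proof: take the table `Γ (some a) c = [a = e(c)]`, `Γ none = 0`; the subset sums are
`Q_{u_i}(c) = [e(c) ∈ u_i] ∈ {0,1}` and encode the rows onto `𝒫(T)`, so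
`…SubsetSumDoor.partitionMinor_hit_of_cubeEncoding` applies (the layout matrix of the witness is the
inclusion matrix of `𝒫(T)`).

EXAMPLES (all of size `r = 2^|T|`, up to `2^{h/2}`): rows = any binary LINEAR or affine CODE of
dimension `|T|` (an information set always exists), rows = the GRAPH FAMILY `{S ∪ f(S) : S ⊆ I}` of an
ARBITRARY map `f : 𝒫(I) → 𝒫(Fin h ∖ I)` with `|I| = |T|`. For a generic `f` (or a code of minimum
distance `≥ 3`) such a row family contains no positive-dimensional subcube and does not factor over
coordinate blocks, so — unlike the symmetric or product layouts — it is not reached by the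
cell/strata/automorphic/block-product doors; the subset-sum witness reaches it with one table `Γ`.

WHAT THIS IS NOT: rows without an information set of size `log₂ r` (e.g. all small sets) need the
recursive-split criterion (`…SubsetSumRecursiveSplits`) and the open even-split lemma; nothing here on
crux 14610 or `VP ≠ VNP`.
-/

set_option linter.dupNamespace false

open Finset MvPolynomial

namespace Summit.ValiantsHypothesis.ValiantsHypothesis.Theorems.BarrierLever.SubsetSum

open Literature.Barriers.ValiantsHypothesis

/-- **Information-set layouts are hit.** Columns = all subsets of `T`; rows realize every pattern
`W ⊆ T` as `{c ∈ T : e(c) ∈ u_i}` for coordinates `e(c)`, `c ∈ T`. Then some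
`f ∈ SmallCircuits ℂ (h+h) 5` (the subset-sum witness with the `0/1` table `Γ (some a) c = [a = e c]`)
has a nonsingular layout matrix. -/
theorem partitionMinor_hit_of_informationSet {h : ℕ} (hh : 4 ≤ h) {r : ℕ}
    (u w : Fin r → Finset (Fin h)) (T : Finset (Fin h)) (hwT : ∀ j, w j ⊆ T)
    (hwinj : Function.Injective w) (hwsurj : ∀ W, W ⊆ T → ∃ j, w j = W)
    (e : Fin h → Fin h) (hrows : ∀ W, W ⊆ T → ∃ i, ∀ c ∈ T, e c ∈ u i ↔ c ∈ W) :
    ∃ f ∈ SmallCircuits ℂ (h + h) 5,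
      (Matrix.of fun i j : Fin r => MvPolynomial.coeff
        (∑ a ∈ u i, Finsupp.single (Fin.castAdd h a) 1 +
          ∑ c ∈ w j, Finsupp.single (Fin.natAdd h c) 1) f).det ≠ 0 := by
  classical
  -- the encoding table: `Γ none = 0`, `Γ (some a) c = [a = e c]`
  let Γ : Option (Fin h) → Fin h → ℂ := fun o c =>
    match o with
    | none => 0
    | some a => if a = e c then 1 else 0
  have hQ : ∀ i (c : Fin h), (Γ none c + ∑ a ∈ u i, Γ (some a) c) = if e c ∈ u i then 1 else 0 := by
    intro i c
    simp only [Γ, zero_add]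
    rw [Finset.sum_ite_eq' (u i) (e c)]
  refine partitionMinor_hit_of_cubeEncoding hh u w T hwT hwinj hwsurj Γ ?_ ?_
  · intro i x _
    rw [hQ i x]
    by_cases hx : e x ∈ u i
    · exact Or.inr (if_pos hx)
    · exact Or.inl (if_neg hx)
  · intro W hW
    obtain ⟨i, hi⟩ := hrows W hW
    refine ⟨i, fun x hx => ?_⟩
    rw [hQ i x]
    constructor
    · intro h1
      by_cases hx' : e x ∈ u i
      · exact (hi x hx).1 hx'
      · rw [if_neg hx'] at h1; exact absurd h1 zero_ne_one
    · intro hxW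
      rw [if_pos ((hi x hx).2 hxW)]

/-- **Graph families.** The special case where the rows are indexed so that row `i`'s trace on the
coordinates `e(T)` is prescribed by the column enumeration itself: `e c ∈ u i ↔ c ∈ w i` (row `i`
«carries the message `w i`» on the information positions and anything elsewhere). -/
theorem partitionMinor_hit_of_graphFamily {h : ℕ} (hh : 4 ≤ h) {r : ℕ}
    (u w : Fin r → Finset (Fin h)) (T : Finset (Fin h)) (hwT : ∀ j, w j ⊆ T)
    (hwinj : Function.Injective w) (hwsurj : ∀ W, W ⊆ T → ∃ j, w j = W)
    (e : Fin h → Fin h) (hmsg : ∀ i, ∀ c ∈ T, e c ∈ u i ↔ c ∈ w i) :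
    ∃ f ∈ SmallCircuits ℂ (h + h) 5,
      (Matrix.of fun i j : Fin r => MvPolynomial.coeff
        (∑ a ∈ u i, Finsupp.single (Fin.castAdd h a) 1 +
          ∑ c ∈ w j, Finsupp.single (Fin.natAdd h c) 1) f).det ≠ 0 :=
  partitionMinor_hit_of_informationSet hh u w T hwT hwinj hwsurj e fun W hW => by
    obtain ⟨j, hj⟩ := hwsurj W hW
    exact ⟨j, fun c hc => by rw [hmsg j c hc, hj]⟩

end Summit.ValiantsHypothesis.ValiantsHypothesis.Theorems.BarrierLever.SubsetSum
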